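import Literature.NumberTheory.Sieve.SmoothCountSaddleRegimeA
import Literature.NumberTheory.Sieve.SmoothSaddlePointXi
import Literature.NumberTheory.Sieve.SmoothCountDeBruijnCrude
import HarnessLib

/-!
# The local behaviour of Dickman's function: `ρ(u + v) = ρ(u) e^{-vξ(u)} (1 + O(1/u))`, `0 ≤ v ≤ 1`

Topic `Literature/NumberTheory/Sieve`; a PROVED tool file toward `Literature.NumberTheory.Sieve.HTLocalBehaviour`
(Hildebrand–Tenenbaum 1986, Theorem 3) in the range of small `u`, where `Ψ(cx, y)/Ψ(x, y)` is computed from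
de Bruijn's approximation `xρ(u)` (`abs_card_sub_mul_dickmanRho_le`) and one needs the local behaviour of `ρ`
([HildebrandTenenbaum1986, Lemma 1 / (2.8) and Cor. of Thm 3]: `ρ(u - t)/ρ(u) = e^{tξ(u)}(1 + O(1/u))`).
We obtain it WITHOUT the Laplace-inversion analysis of `ρ`, by transport from friable integers at an
auxiliary, very large `y' = ⌈e^{u³}⌉`: there `Ψ(y'^{u+v}, y')/Ψ(y'^u, y')` equals `y'^v ρ(u+v)/ρ(u) (1 + O(1/u))`
by Hildebrand's induction (`abs_card_sub_mul_dickmanRho_le`), and `y'^{vα} (1 + O(1/u))` by the saddle-point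
theorem in its polylogarithmic range (`exists_card_smooth_saddle_regimeA`, `exists_abs_log_mainTerm_sub_le`),
while `(1 - α) log y' = ξ(u) + O(u/log y')` (`exists_abs_one_sub_saddlePoint_mul_log_sub_dickmanXi_le`).

* `abs_dickmanRho_add_mul_exp_sub_le` — **the estimate**: `|ρ(u+v) e^{vξ(u)} - ρ(u)| ≤ (C/u) ρ(u)` for
  `u ≥ u₀`, `0 ≤ v ≤ 1`.

## References

* [HildebrandTenenbaum1986] A. Hildebrand, G. Tenenbaum, Trans. AMS 296 (1986) 265–290, Lemma 1, (2.6)–(2.8),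
  Corollary of Theorem 3 (p. 269).
* [Hildebrand1986] A. Hildebrand, J. Number Theory 22 (1986) 289–307, Lemma 1 (vi).
-/

noncomputable section

open Real Filter

namespace Literature.NumberTheory.Sieve

namespace DickmanLocalRatio

/-- Eventually `64 u¹² ≤ e^{u³}`. [folklore] -/
theorem eventually_pow_le_exp_cube : ∀ᶠ u : ℝ in atTop, 64 * u ^ 12 ≤ Real.exp (u ^ 3) := by
  have h := (Real.tendsto_pow_mul_exp_neg_atTop_nhds_zero 12).eventually (gt_mem_nhds (show (0 : ℝ) < 1 / 64 by norm_num))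
  filter_upwards [h, eventually_ge_atTop 1] with u hu hu1
  have h1 : Real.exp u ≤ Real.exp (u ^ 3) := Real.exp_le_exp.2 (le_self_pow₀ hu1 (by norm_num))
  have h2 : u ^ 12 * Real.exp (-u) * Real.exp u = u ^ 12 := by rw [mul_assoc, ← Real.exp_add]; simp
  have h3 : 64 * u ^ 12 ≤ Real.exp u := by
    rw [← h2]; have := Real.exp_pos u; nlinarith
  linarith

/-- Eventually `(log 2 + 3 log u)³ ≤ u`. [folklore] -/
theorem eventually_log_cube_le : ∀ᶠ u : ℝ in atTop, (Real.log 2 + 3 * Real.log u) ^ 3 ≤ u := by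
  have h := (isLittleO_log_rpow_rpow_atTop 3 (show (0 : ℝ) < 1 by norm_num)).bound (show (0 : ℝ) < 1 / 64 by norm_num)
  filter_upwards [h, eventually_ge_atTop 2] with u hu hu2
  have hl0 : 0 ≤ Real.log u := Real.log_nonneg (by linarith)
  rw [Real.rpow_one, Real.norm_of_nonneg (Real.rpow_nonneg hl0 _), Real.norm_of_nonneg (by linarith)] at hu
  have h3 : Real.log u ^ (3 : ℝ) = Real.log u ^ 3 := by norm_cast
  rw [h3] at hu
  have hl2 : Real.log 2 ≤ Real.log u := Real.log_le_log two_pos hu2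
  calc (Real.log 2 + 3 * Real.log u) ^ 3 ≤ (4 * Real.log u) ^ 3 := by
        apply pow_le_pow_left₀ (by positivity); linarith
    _ = 64 * Real.log u ^ 3 := by ring
    _ ≤ u := by linarith

end DickmanLocalRatio

open DickmanLocalRatio in
set_option maxHeartbeats 3000000 in
/-- **Local behaviour of `ρ`.** There are `C ≥ 0` and `u₀` with
`|ρ(u + v) e^{vξ(u)} - ρ(u)| ≤ (C/u) ρ(u)` for all `u ≥ u₀`, `0 ≤ v ≤ 1` (`e^{ξ(u)} = 1 + uξ(u)`), i.e.
`ρ(u+v)/ρ(u) = e^{-vξ(u)}(1 + O(1/u))` — proved by transport from `Ψ(·, y')`, `y' = ⌈e^{u³}⌉` (see the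
module docstring). [cite: HildebrandTenenbaum1986, (2.8) and Corollary to Theorem 3] -/
theorem abs_dickmanRho_add_mul_exp_sub_le :
    ∃ C u₀ : ℝ, 0 ≤ C ∧ ∀ (u v : ℝ), u₀ ≤ u → 0 ≤ v → v ≤ 1 →
      |dickmanRho (u + v) * Real.exp (v * dickmanXi u) - dickmanRho u| ≤ C / u * dickmanRho u := by
  obtain ⟨C₁, c₁, hc₁, y₁, hP⟩ := abs_card_sub_mul_dickmanRho_le
  obtain ⟨CA, yA, uA, hA⟩ := exists_card_smooth_saddle_regimeA
  obtain ⟨K, yK, hK0, hyK2, hM⟩ := exists_abs_log_mainTerm_sub_le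
  obtain ⟨Cξ, yξ, uξ, huξ1, hΞ⟩ := exists_abs_one_sub_saddlePoint_mul_log_sub_dickmanXi_le
  obtain ⟨U₃, hU₃⟩ := Filter.eventually_atTop.1 eventually_pow_le_exp_cube
  obtain ⟨U₄, hU₄⟩ := Filter.eventually_atTop.1 eventually_log_cube_le
  set C₁' := max C₁ 0 with hC₁'
  set CA' := max CA 0 with hCA'
  have hC₁'0 : 0 ≤ C₁' := le_max_right _ _
  have hCA'0 : 0 ≤ CA' := le_max_right _ _
  have hCξ0 : 0 ≤ Cξ ∨ Cξ < 0 := le_or_gt 0 Cξ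
  set Cξ' := max Cξ 0 with hCξ'
  have hCξ'0 : 0 ≤ Cξ' := le_max_right _ _
  set Cstar : ℝ := 14 * C₁' + 4 * CA' + K + Cξ' with hCstar
  have hCstar0 : 0 < Cstar := by positivity
  set Ymax : ℝ := max (max (y₁ : ℝ) yA) (max (yK : ℝ) yξ) with hYmax
  refine ⟨2 * Cstar, max (max (max 2 Ymax) (max (4 / c₁ + 1) (max uA uξ))) (max (max (10 * C₁' + 4 * CA') Cstar) (max U₃ U₄)),
    by positivity, fun u v hu hv0 hv1 => ?_⟩
  -- unpack the thresholds
  have hu2 : 2 ≤ u := le_trans (le_max_left _ _) (le_trans (le_max_left _ _) (le_trans (le_max_left _ _) hu))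
  have huY : Ymax ≤ u := le_trans (le_max_right _ _) (le_trans (le_max_left _ _) (le_trans (le_max_left _ _) hu))
  have huc₁ : 4 / c₁ + 1 ≤ u := le_trans (le_max_left _ _) (le_trans (le_max_right _ _) (le_trans (le_max_left _ _) hu))
  have huA : uA ≤ u := le_trans (le_max_left _ _) (le_trans (le_max_right _ _) (le_trans (le_max_right _ _) (le_trans (le_max_left _ _) hu)))
  have huξ : uξ ≤ u := le_trans (le_max_right _ _) (le_trans (le_max_right _ _) (le_trans (le_max_right _ _) (le_trans (le_max_left _ _) hu)))
  have huE : 10 * C₁' + 4 * CA' ≤ u := le_trans (le_max_left _ _) (le_trans (le_max_left _ _) (le_trans (le_max_right _ _) hu))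
  have huS : Cstar ≤ u := le_trans (le_max_right _ _) (le_trans (le_max_left _ _) (le_trans (le_max_right _ _) hu))
  have hU₃u : U₃ ≤ u := le_trans (le_max_left _ _) (le_trans (le_max_right _ _) (le_trans (le_max_right _ _) hu))
  have hU₄u : U₄ ≤ u := le_trans (le_max_right _ _) (le_trans (le_max_right _ _) (le_trans (le_max_right _ _) hu))
  have hu1 : 1 ≤ u := by linarith
  have hu0 : 0 < u := by linarith
  -- the auxiliary `y'`
  set y' : ℕ := ⌈Real.exp (u ^ 3)⌉₊ with hy'
  have hey : Real.exp (u ^ 3) ≤ y' := Nat.le_ceil _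
  have hye : (y' : ℝ) ≤ Real.exp (u ^ 3) + 1 := (Nat.ceil_lt_add_one (Real.exp_pos _).le).le
  have hu3 : u ≤ u ^ 3 := le_self_pow₀ hu1 (by norm_num)
  have heu : u ^ 3 + 1 ≤ Real.exp (u ^ 3) := Real.add_one_le_exp _
  have hy'u : u ≤ y' := by linarith
  have hy'16 : (2 : ℝ) ≤ y' := by linarith
  have hy'0 : (0 : ℝ) < y' := by linarith
  have hy'1 : (1 : ℝ) < y' := by linarith
  set L' := Real.log y' with hL'
  have hL'lo : u ^ 3 ≤ L' := by
    rw [hL', Real.le_log_iff_exp_le hy'0]; exact hey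
  have hL'hi : L' ≤ u ^ 3 + 1 := by
    have h1 : (y' : ℝ) ≤ 2 * Real.exp (u ^ 3) := by have := Real.add_one_le_exp (u ^ 3); nlinarith [Real.exp_pos (u ^ 3)]
    have h2 : Real.log y' ≤ Real.log (2 * Real.exp (u ^ 3)) := Real.log_le_log hy'0 h1
    rw [Real.log_mul two_ne_zero (Real.exp_pos _).ne', Real.log_exp] at h2
    have : Real.log 2 ≤ 1 := by have := Real.log_le_sub_one_of_pos two_pos; linarith
    linarith
  have hL'0 : 0 < L' := by nlinarith
  have huL' : u ≤ L' := hu3.trans hL'lo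
  -- thresholds on `y'`
  have hyall : (y₁ : ℝ) ≤ y' ∧ (yA : ℝ) ≤ y' ∧ (yK : ℝ) ≤ y' ∧ (yξ : ℝ) ≤ y' := by
    have h := huY.trans hy'u
    refine ⟨?_, ?_, ?_, ?_⟩ <;> [exact le_trans (le_trans (le_max_left _ _) (le_max_left _ _)) h;
      exact le_trans (le_trans (le_max_right _ _) (le_max_left _ _)) h;
      exact le_trans (le_trans (le_max_left _ _) (le_max_right _ _)) h;
      exact le_trans (le_trans (le_max_right _ _) (le_max_right _ _)) h]
  have hy₁ : y₁ ≤ y' := by exact_mod_cast hyall.1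
  have hyA : yA ≤ y' := by exact_mod_cast hyall.2.1
  have hyK : yK ≤ y' := by exact_mod_cast hyall.2.2.1
  have hyξ : yξ ≤ y' := by exact_mod_cast hyall.2.2.2
  -- `x' = y'^u`, `c' = y'^v`, `x'' = c' x' = y'^{u+v}`
  set x' : ℝ := (y' : ℝ) ^ u with hx'
  set c' : ℝ := (y' : ℝ) ^ v with hc'
  have hx'0 : 0 < x' := Real.rpow_pos_of_pos hy'0 _
  have hc'0 : 0 < c' := Real.rpow_pos_of_pos hy'0 _
  have hlogx' : Real.log x' = u * L' := by rw [hx', Real.log_rpow hy'0]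
  have hlogc' : Real.log c' = v * L' := by rw [hc', Real.log_rpow hy'0]
  have hlogx'' : Real.log (c' * x') = (u + v) * L' := by
    rw [Real.log_mul hc'0.ne' hx'0.ne', hlogx', hlogc']; ring
  have hc'1 : 1 ≤ c' := Real.one_le_rpow hy'1.le hv0
  have hc'y : c' ≤ y' := by
    calc c' ≤ (y' : ℝ) ^ (1 : ℝ) := Real.rpow_le_rpow_of_exponent_le hy'1.le hv1
      _ = y' := Real.rpow_one _
  have hyx' : (y' : ℝ) ≤ x' := by
    calc (y' : ℝ) = (y' : ℝ) ^ (1 : ℝ) := (Real.rpow_one _).symm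
      _ ≤ x' := Real.rpow_le_rpow_of_exponent_le hy'1.le hu1
  have hyx'' : (y' : ℝ) ≤ c' * x' := hyx'.trans (le_mul_of_one_le_left hx'0.le hc'1)
  have hx''0 : 0 < c' * x' := by positivity
  have hux' : Real.log x' / L' = u := by rw [hlogx']; field_simp
  have hux'' : Real.log (c' * x') / L' = u + v := by rw [hlogx'']; field_simp
  have huv1 : u ≤ u + v := by linarith
  have huv2 : u + v ≤ u + 1 := by linarith
  -- range conditions
  have hc₁u : (u + 1) ^ 2 ≤ c₁ * L' := by
    have h1 : 4 / c₁ ≤ u := by linarith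
    have h2 : 4 ≤ c₁ * u := by rwa [div_le_iff₀ hc₁, mul_comm] at h1
    have h3 : c₁ * u ^ 3 ≤ c₁ * L' := mul_le_mul_of_nonneg_left hL'lo hc₁.le
    have h4 : 4 * u ^ 2 ≤ c₁ * u * u ^ 2 := mul_le_mul_of_nonneg_right h2 (sq_nonneg u)
    have h5 : (u + 1) ^ 2 ≤ 4 * u ^ 2 := by nlinarith
    have e : c₁ * u * u ^ 2 = c₁ * u ^ 3 := by ring
    linarith
  have hreg : ∀ w : ℝ, u ≤ w → w ≤ u + 1 → (w * L') ^ 3 ≤ y' := by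
    intro w hw1 hw2
    have h1 : w * L' ≤ 4 * u ^ 4 := by nlinarith
    have h2 : (w * L') ^ 3 ≤ (4 * u ^ 4) ^ 3 := pow_le_pow_left₀ (by nlinarith) h1 3
    have h3 : (4 * u ^ 4) ^ 3 = 64 * u ^ 12 := by ring
    have h4 := hU₃ u hU₃u
    linarith
  have hll : Real.log (Real.log y') ^ 3 ≤ u := by
    rw [← hL']
    have h1 : Real.log L' ≤ Real.log 2 + 3 * Real.log u := by
      have h2 : L' ≤ 2 * u ^ 3 := by nlinarith
      calc Real.log L' ≤ Real.log (2 * u ^ 3) := Real.log_le_log hL'0 h2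
        _ = Real.log 2 + 3 * Real.log u := by rw [Real.log_mul two_ne_zero (by positivity), Real.log_pow]; norm_num
    have h3 : 0 ≤ Real.log L' := Real.log_nonneg (by nlinarith)
    exact (pow_le_pow_left₀ h3 h1 3).trans (hU₄ u hU₄u)
  -- (1)(2): Hildebrand's induction at `x'` and `c' x'`
  have hP1 := hP y' x' hy₁ hyx' (by rw [hux']; nlinarith)
  have hP2 := hP y' (c' * x') hy₁ hyx'' (by rw [hux'']; nlinarith)
  rw [hux'] at hP1
  rw [hux''] at hP2
  -- (3)(4): the saddle-point theorem at `x'` and `c' x'`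
  have hA1 := hA x' y' hyA (by rw [hlogx']; exact hreg u le_rfl (by linarith)) hyx' (by rw [hux']; exact huA)
    (by rw [hux']; exact hll)
  have hA2 := hA (c' * x') y' hyA (by rw [hlogx'']; exact hreg (u + v) huv1 huv2) hyx''
    (by rw [hux'']; linarith) (by rw [hux'']; linarith)
  rw [hux'] at hA1
  rw [hux''] at hA2
  -- (5): the main terms, (6): `(1 - α) L' = ξ(u) + O(u/L')`
  have hM1 := hM x' y' c' hyK hyx' hc'1 hc'y
  have hΞ1 := hΞ x' y' hyξ hyx' (by rw [hlogx']; nlinarith) (by rw [hlogx']; nlinarith)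
  rw [hux'] at hΞ1
  rw [hlogx'] at hM1
  -- positivity of the models
  set α := saddlePoint x' y' with hα
  set α₂ := saddlePoint (c' * x') y' with hα₂
  have hy'2 : 2 ≤ y' := by exact_mod_cast (show (2 : ℝ) ≤ y' from hy'16)
  have hx'1 : 1 < x' := lt_of_lt_of_le hy'1 hyx'
  have hx''1 : 1 < c' * x' := lt_of_lt_of_le hy'1 hyx''
  have hαpos : 0 < α := saddlePoint_pos hx'1 hy'2
  have hα₂pos : 0 < α₂ := saddlePoint_pos hx''1 hy'2
  set M₁ := x' ^ α * smoothZeta α y' / (α * Real.sqrt (2 * Real.pi * saddlePhi₂ α y')) with hM₁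
  set M₂ := (c' * x') ^ α₂ * smoothZeta α₂ y' / (α₂ * Real.sqrt (2 * Real.pi * saddlePhi₂ α₂ y')) with hM₂
  have hM₁0 : 0 < M₁ := by
    have := smoothZeta_pos (y := y') hαpos
    have := saddlePhi₂_pos hy'2 hαpos
    positivity
  have hM₂0 : 0 < M₂ := by
    have := smoothZeta_pos (y := y') hα₂pos
    have := saddlePhi₂_pos hy'2 hα₂pos
    positivity
  have hρ1 : 0 < dickmanRho u := dickmanRho_pos u
  have hρ2 : 0 < dickmanRho (u + v) := dickmanRho_pos _
  have hm1 : 0 < x' * dickmanRho u := mul_pos hx'0 hρ1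
  have hm2 : 0 < c' * x' * dickmanRho (u + v) := mul_pos hx''0 hρ2
  -- the relative errors are `≤ const/u ≤ 1/2`
  have hE1 : C₁ * (u ^ 2 + 1) / L' ≤ 2 * C₁' / u := by
    have h1 : C₁ * (u ^ 2 + 1) / L' ≤ C₁' * (u ^ 2 + 1) / L' :=
      div_le_div_of_nonneg_right (mul_le_mul_of_nonneg_right (le_max_left _ _) (by positivity)) hL'0.le
    have h2 : C₁' * (u ^ 2 + 1) / L' ≤ C₁' * (u ^ 2 + 1) / u ^ 3 :=
      div_le_div_of_nonneg_left (by positivity) (by positivity) hL'lo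
    have h3 : C₁' * (u ^ 2 + 1) / u ^ 3 ≤ 2 * C₁' / u := by
      rw [div_le_div_iff₀ (by positivity) hu0]
      have h4 := mul_le_mul_of_nonneg_left hu3 hC₁'0
      have e1 : C₁' * (u ^ 2 + 1) * u = C₁' * u ^ 3 + C₁' * u := by ring
      have e2 : 2 * C₁' * u ^ 3 = C₁' * u ^ 3 + C₁' * u ^ 3 := by ring
      rw [e1, e2]; linarith
    linarith
  have hE2 : C₁ * ((u + v) ^ 2 + 1) / L' ≤ 5 * C₁' / u := by
    have h1 : C₁ * ((u + v) ^ 2 + 1) / L' ≤ C₁' * ((u + v) ^ 2 + 1) / L' :=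
      div_le_div_of_nonneg_right (mul_le_mul_of_nonneg_right (le_max_left _ _) (by positivity)) hL'0.le
    have h2 : C₁' * ((u + v) ^ 2 + 1) / L' ≤ C₁' * ((u + v) ^ 2 + 1) / u ^ 3 :=
      div_le_div_of_nonneg_left (by positivity) (by positivity) hL'lo
    have h3 : C₁' * ((u + v) ^ 2 + 1) / u ^ 3 ≤ 5 * C₁' / u := by
      rw [div_le_div_iff₀ (by positivity) hu0]
      have h4 : (u + v) ^ 2 + 1 ≤ 5 * u ^ 2 := by nlinarith
      have h5 := mul_le_mul_of_nonneg_left h4 (by positivity : 0 ≤ C₁' * u)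
      have e1 : C₁' * ((u + v) ^ 2 + 1) * u = C₁' * u * ((u + v) ^ 2 + 1) := by ring
      have e2 : 5 * C₁' * u ^ 3 = C₁' * u * (5 * u ^ 2) := by ring
      rw [e1, e2]; exact h5
    linarith
  have hEA1 : CA / u ≤ CA' / u := div_le_div_of_nonneg_right (le_max_left _ _) hu0.le
  have hEA2 : CA / (u + v) ≤ CA' / u :=
    (div_le_div_of_nonneg_right (le_max_left _ _) (by linarith)).trans
      (div_le_div_of_nonneg_left hCA'0 hu0 huv1)
  have hsmall1 : 2 * C₁' / u ≤ 1 / 2 := by rw [div_le_iff₀ hu0]; linarith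
  have hsmall2 : 5 * C₁' / u ≤ 1 / 2 := by rw [div_le_iff₀ hu0]; linarith
  have hsmallA : CA' / u ≤ 1 / 2 := by rw [div_le_iff₀ hu0]; linarith
  -- logarithms
  have hL1 := (abs_log_sub_log_le_of_abs_sub_le hm1 (by positivity) hsmall1
    (hP1.trans (mul_le_mul_of_nonneg_right hE1 hm1.le))).2
  have hL2 := (abs_log_sub_log_le_of_abs_sub_le hm2 (by positivity) hsmall2
    (hP2.trans (mul_le_mul_of_nonneg_right hE2 hm2.le))).2
  have hL3 := (abs_log_sub_log_le_of_abs_sub_le hM₁0 (by positivity) hsmallA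
    (hA1.trans (mul_le_mul_of_nonneg_right hEA1 hM₁0.le))).2
  have hL4 := (abs_log_sub_log_le_of_abs_sub_le hM₂0 (by positivity) hsmallA
    (hA2.trans (mul_le_mul_of_nonneg_right hEA2 hM₂0.le))).2
  -- the main terms in logarithmic form
  have hlM₁ : Real.log M₁ = α * Real.log x' + Real.log (smoothZeta α y') - Real.log α -
      1 / 2 * Real.log (2 * Real.pi * saddlePhi₂ α y') := log_mainTerm_eq hx'1 hy'2 hαpos
  have hlM₂ : Real.log M₂ = α₂ * Real.log (c' * x') + Real.log (smoothZeta α₂ y') - Real.log α₂ -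
      1 / 2 * Real.log (2 * Real.pi * saddlePhi₂ α₂ y') := log_mainTerm_eq hx''1 hy'2 hα₂pos
  have hL5 : |Real.log M₂ - Real.log M₁ - α * Real.log c'| ≤ K / u := by
    rw [hlM₁, hlM₂, hlogx']
    have : K * (Real.log y' / (u * L')) = K / u := by rw [← hL']; field_simp
    rw [this] at hM1
    exact hM1
  -- expand the logarithms of the models
  have hlm1 : Real.log (x' * dickmanRho u) = u * L' + Real.log (dickmanRho u) := by
    rw [Real.log_mul hx'0.ne' hρ1.ne', hlogx']
  have hlm2 : Real.log (c' * x' * dickmanRho (u + v)) = (u + v) * L' + Real.log (dickmanRho (u + v)) := by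
    rw [Real.log_mul hx''0.ne' hρ2.ne', hlogx'']
  -- `R = log ρ(u+v) - log ρ(u) + v ξ(u)`
  set R := Real.log (dickmanRho (u + v)) - Real.log (dickmanRho u) + v * dickmanXi u with hR
  have hRT : R = -(Real.log ((Nat.smoothNumbersUpTo ⌊c' * x'⌋₊ (y' + 1)).card : ℝ) - Real.log (c' * x' * dickmanRho (u + v)))
      + (Real.log ((Nat.smoothNumbersUpTo ⌊c' * x'⌋₊ (y' + 1)).card : ℝ) - Real.log M₂)
      + (Real.log M₂ - Real.log M₁ - α * Real.log c')
      - (Real.log ((Nat.smoothNumbersUpTo ⌊x'⌋₊ (y' + 1)).card : ℝ) - Real.log M₁)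
      + (Real.log ((Nat.smoothNumbersUpTo ⌊x'⌋₊ (y' + 1)).card : ℝ) - Real.log (x' * dickmanRho u))
      - v * ((1 - α) * L' - dickmanXi u) := by
    rw [hR, hlm1, hlm2, hlogc']; ring
  have hΞv : |v * ((1 - α) * L' - dickmanXi u)| ≤ Cξ' / u := by
    rw [abs_mul, abs_of_nonneg hv0]
    have h1 : |(1 - α) * L' - dickmanXi u| ≤ Cξ' * u / L' :=
      hΞ1.trans (div_le_div_of_nonneg_right (mul_le_mul_of_nonneg_right (le_max_left _ _) hu0.le) hL'0.le)
    have h2 : Cξ' * u / L' ≤ Cξ' / u := by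
      rw [div_le_div_iff₀ hL'0 hu0]
      have h3 : u ^ 2 ≤ u ^ 3 := pow_le_pow_right₀ hu1 (by norm_num)
      have h4 := mul_le_mul_of_nonneg_left (h3.trans hL'lo) hCξ'0
      have e : Cξ' * u * u = Cξ' * u ^ 2 := by ring
      rw [e]; exact h4
    calc v * |(1 - α) * L' - dickmanXi u| ≤ 1 * (Cξ' / u) := mul_le_mul hv1 (h1.trans h2) (abs_nonneg _) zero_le_one
      _ = Cξ' / u := one_mul _
  have hRabs : |R| ≤ Cstar / u := by
    rw [hRT]
    have e : Cstar / u = 2 * (5 * C₁' / u) + 2 * (CA' / u) + K / u + 2 * (CA' / u) + 2 * (2 * C₁' / u) + Cξ' / u := by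
      rw [hCstar]; field_simp; ring
    rw [e]
    refine (abs_sub _ _).trans (add_le_add ((abs_add_le _ _).trans (add_le_add ((abs_sub _ _).trans
      (add_le_add ((abs_add_le _ _).trans (add_le_add ((abs_add_le _ _).trans (add_le_add ?_ hL4)) hL5)) hL3)) hL1)) hΞv)
    rw [abs_neg]; exact hL2
  have hR1 : |R| ≤ 1 := hRabs.trans ((div_le_one hu0).2 huS)
  -- exponentiate
  have hkey : dickmanRho (u + v) * Real.exp (v * dickmanXi u) = Real.exp R * dickmanRho u := by
    rw [hR, Real.exp_add, Real.exp_sub, Real.exp_log hρ2, Real.exp_log hρ1]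
    field_simp
  rw [hkey, show Real.exp R * dickmanRho u - dickmanRho u = (Real.exp R - 1) * dickmanRho u by ring, abs_mul,
    abs_of_pos hρ1]
  refine mul_le_mul_of_nonneg_right ?_ hρ1.le
  calc |Real.exp R - 1| ≤ 2 * |R| := abs_exp_sub_one_le hR1
    _ ≤ 2 * (Cstar / u) := by linarith
    _ = 2 * Cstar / u := by ring

end Literature.NumberTheory.Sieve

end
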